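import Mathlib

/-!
# Clause 13-J, brick B6′ (I1): the TRACE IDENTITY ALONG THE TANGENCY BALL — `w′ = ⟪Dv·X′, X′⟫` and
# `⟪A m, m⟫ + ⟪A n, n⟫ = tr A − w′`

Route `FilamentSkeletonRss`, child 28296 `Clause13NearStraight` (and its A1L twin); design of record
`filament-plan/DESIGN-NOTE-28296-tenure-g22.md` §3 (I1) + lane memo `DESIGN-28296-transport-g13.md` §3 (H).
On the exactness ball the tangency clause reads `v (X τ) = w τ • X′ τ`; differentiating along the filament (chain rule for `v ∘ X`,
product rule for `w • X′`) gives `Dv(X τ)·X′ τ = w′ τ • X′ τ + w τ • X″ τ` at EVERY station (`tangency_fderiv_tangent`; at the waist,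
where `w = 0`, this is the eigenvector law `…SelectionBoxRJRung.box_eigenvector_law`), and unit speed (`⟪X″, X′⟫ = 0`,
`inner_deriv_deriv_deriv_eq_zero`) gives the SLIP-STRETCHING IDENTITY `w′ τ = ⟪Dv(X τ)·X′ τ, X′ τ⟫` (`deriv_slip_eq_inner`).  Hence for
any orthonormal completion `(X′ τ, m, n)` the normal block of `A = Dv(X τ)` has trace `tr A − w′ τ` (`normalBlock_trace_eq_sub_slip`);
with the divergence-free matched field (`…MatchedKernel.matchedSkeletonField_trace_eq`: `tr Dv = 3/2`) this is the identity
`tr_N Dv = 3/2 − w′` of the tenure note (I1), whose half `β̄ = ¾ − w′/2` is the J-averaged growth rate of the far transport branch.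
Pure calculus, typing-agnostic (A1G/A1L).  Lane ns-filament-19175-p1 g13; `--supports stmt-NavierStokesRegularity-28296 --as helper`.
HONEST FRAMING: calculus for a HYPOTHETICAL filament skeleton on the NEGATIVE side of a MODEL route; nothing here bears on
Navier–Stokes regularity or blow-up.
-/

noncomputable section

open scoped InnerProductSpace
open Filter Topology

namespace Summit.NavierStokesRegularity.NavierStokesRegularity.Theorems.MatchedKernel
set_option linter.dupNamespace false

/-- **Differentiated tangency at a general station.**  If `v (X s) = w s • X′ s` for `s` near `τ` (`X ∈ C²`, `w` differentiable at
`τ`, `v` differentiable at `X τ`), then `Dv(X τ)·X′ τ = w τ • X″ τ + w′ τ • X′ τ`. [folklore] -/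
theorem tangency_fderiv_tangent {v : EuclideanSpace ℝ (Fin 3) → EuclideanSpace ℝ (Fin 3)}
    {X : ℝ → EuclideanSpace ℝ (Fin 3)} {w : ℝ → ℝ} {τ : ℝ}
    (hX : ContDiff ℝ 2 X) (hw : DifferentiableAt ℝ w τ) (hv : DifferentiableAt ℝ v (X τ))
    (htan : ∀ᶠ s in 𝓝 τ, v (X s) = w s • deriv X s) :
    fderiv ℝ v (X τ) (deriv X τ) = w τ • deriv (deriv X) τ + deriv w τ • deriv X τ := by
  have hXd : Differentiable ℝ X := hX.differentiable (by norm_num)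
  have hTd : Differentiable ℝ (deriv X) := hX.differentiable_deriv_two
  have h1 : HasDerivAt (fun s => v (X s)) (fderiv ℝ v (X τ) (deriv X τ)) τ :=
    hv.hasFDerivAt.comp_hasDerivAt τ (hXd τ).hasDerivAt
  have h2 : HasDerivAt (fun s => w s • deriv X s) (w τ • deriv (deriv X) τ + deriv w τ • deriv X τ) τ :=
    hw.hasDerivAt.smul (hTd τ).hasDerivAt
  exact h1.unique (h2.congr_of_eventuallyEq htan)

/-- Unit speed ⇒ the acceleration is normal: `⟪X″ τ, X′ τ⟫ = 0`. [folklore] -/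
theorem inner_deriv_deriv_deriv_eq_zero {X : ℝ → EuclideanSpace ℝ (Fin 3)} (hX : ContDiff ℝ 2 X)
    (hunit : ∀ s, ‖deriv X s‖ = 1) (τ : ℝ) : ⟪deriv (deriv X) τ, deriv X τ⟫_ℝ = 0 := by
  have hTd : Differentiable ℝ (deriv X) := hX.differentiable_deriv_two
  have h := ((hTd τ).hasDerivAt).inner ℝ ((hTd τ).hasDerivAt)
  have hconst : (fun s => ⟪deriv X s, deriv X s⟫_ℝ) = fun _ => (1 : ℝ) := by
    funext s; rw [real_inner_self_eq_norm_sq, hunit s, one_pow]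
  rw [hconst] at h
  have h0 := (hasDerivAt_const τ (1:ℝ)).unique h
  rw [real_inner_comm (deriv X τ)] at h0
  rw [real_inner_comm]
  linarith

/-- **(I1) slip-stretching identity.**  On the tangency ball, `w′ τ = ⟪Dv(X τ)·X′ τ, X′ τ⟫`: the slip slope is the stretching
rate of the frame velocity along the filament. [folklore] -/
theorem deriv_slip_eq_inner {v : EuclideanSpace ℝ (Fin 3) → EuclideanSpace ℝ (Fin 3)}
    {X : ℝ → EuclideanSpace ℝ (Fin 3)} {w : ℝ → ℝ} {τ : ℝ}
    (hX : ContDiff ℝ 2 X) (hunit : ∀ s, ‖deriv X s‖ = 1) (hw : DifferentiableAt ℝ w τ)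
    (hv : DifferentiableAt ℝ v (X τ)) (htan : ∀ᶠ s in 𝓝 τ, v (X s) = w s • deriv X s) :
    deriv w τ = ⟪fderiv ℝ v (X τ) (deriv X τ), deriv X τ⟫_ℝ := by
  rw [tangency_fderiv_tangent hX hw hv htan, inner_add_left, real_inner_smul_left, real_inner_smul_left,
    inner_deriv_deriv_deriv_eq_zero hX hunit τ, real_inner_self_eq_norm_sq, hunit τ]
  ring

/-- **Trace of the normal block at a general station.**  For a linear map `A` on `ℝ³`, an orthonormal frame `(t, m, n)` and the
basis trace `Σᵢ ⟪bᵢ, A bᵢ⟫ = T` (all orthonormal bases): `⟪A m, m⟫ + ⟪A n, n⟫ = T − ⟪A t, t⟫` (no eigenvector relation needed;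
cf. `…SelectionBoxRJRung.normalBlock_trace_eq` at the waist). [folklore] -/
theorem normalBlock_trace_eq_sub (A : EuclideanSpace ℝ (Fin 3) →L[ℝ] EuclideanSpace ℝ (Fin 3))
    {t m n : EuclideanSpace ℝ (Fin 3)} (hon : Orthonormal ℝ ![t, m, n]) {T : ℝ}
    (htr : ∀ (b : OrthonormalBasis (Fin 3) ℝ (EuclideanSpace ℝ (Fin 3))), ∑ i, ⟪b i, A (b i)⟫_ℝ = T) :
    ⟪A m, m⟫_ℝ + ⟪A n, n⟫_ℝ = T - ⟪A t, t⟫_ℝ := by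
  have hsp : Submodule.span ℝ (Set.range ![t, m, n]) = ⊤ :=
    hon.linearIndependent.span_eq_top_of_card_eq_finrank' (by simp)
  set b : OrthonormalBasis (Fin 3) ℝ (EuclideanSpace ℝ (Fin 3)) := OrthonormalBasis.mk hon hsp.ge with hb
  have h := htr b
  have hb0 : b 0 = t := by rw [hb, OrthonormalBasis.coe_mk]; rfl
  have hb1 : b 1 = m := by rw [hb, OrthonormalBasis.coe_mk]; rfl
  have hb2 : b 2 = n := by rw [hb, OrthonormalBasis.coe_mk]; rfl
  rw [Fin.sum_univ_three, hb0, hb1, hb2] at h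
  rw [real_inner_comm m (A m), real_inner_comm n (A n), real_inner_comm t (A t)]
  linarith

/-- **(I1) along the ball.**  With `A = Dv(X τ)`, basis trace `T` and an orthonormal completion `(X′ τ, m, n)`:
`⟪A m, m⟫ + ⟪A n, n⟫ = T − w′ τ`.  For the matched skeleton field `T = 3/2` (`matchedSkeletonField_trace_eq`), so the normal block has
trace `3/2 − w′ τ` at every station of the ball and the J-averaged rate is `β̄ = ¾ − w′/2`. [folklore] -/
theorem normalBlock_trace_eq_sub_slip {v : EuclideanSpace ℝ (Fin 3) → EuclideanSpace ℝ (Fin 3)}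
    {X : ℝ → EuclideanSpace ℝ (Fin 3)} {w : ℝ → ℝ} {τ T : ℝ} {m n : EuclideanSpace ℝ (Fin 3)}
    (hX : ContDiff ℝ 2 X) (hunit : ∀ s, ‖deriv X s‖ = 1) (hw : DifferentiableAt ℝ w τ)
    (hv : DifferentiableAt ℝ v (X τ)) (htan : ∀ᶠ s in 𝓝 τ, v (X s) = w s • deriv X s)
    (hon : Orthonormal ℝ ![deriv X τ, m, n])
    (htr : ∀ (b : OrthonormalBasis (Fin 3) ℝ (EuclideanSpace ℝ (Fin 3))), ∑ i, ⟪b i, fderiv ℝ v (X τ) (b i)⟫_ℝ = T) :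
    ⟪fderiv ℝ v (X τ) m, m⟫_ℝ + ⟪fderiv ℝ v (X τ) n, n⟫_ℝ = T - deriv w τ := by
  rw [normalBlock_trace_eq_sub (fderiv ℝ v (X τ)) hon htr, ← deriv_slip_eq_inner hX hunit hw hv htan]

end Summit.NavierStokesRegularity.NavierStokesRegularity.Theorems.MatchedKernel
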